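import Summits.SmoothPoincare4.SmoothPoincare4.Theorems.SymplecticOrigamiGromovRecognitionRelEndGlueData
import Summits.SmoothPoincare4.SmoothPoincare4.Theorems.SymplecticOrigamiGromovRecognitionRelEndCaseALeaf
import Summits.SmoothPoincare4.SmoothPoincare4.Theorems.SymplecticOrigamiGromovRecognitionRelEndCaseBCounts
import Summits.SmoothPoincare4.SmoothPoincare4.Theorems.SymplecticOrigamiGromovRecognitionRelEndSphereTrappedConst
import Summits.SmoothPoincare4.SmoothPoincare4.Theorems.SymplecticOrigamiGromovRecognitionRelEndLeafChart
import Summits.SmoothPoincare4.SmoothPoincare4.Theorems.SymplecticOrigamiGromovRecognitionRelEndClassCount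
import Summits.SmoothPoincare4.SmoothPoincare4.Theorems.SymplecticOrigamiGromovRecognitionRelEndGluedBasics
import Literature.Geometry.Symplectic.GromovCompactnessSpheres
import Literature.Geometry.Symplectic.JSphereLocalFoliation
import Literature.Geometry.Symplectic.AdjunctionEmbeddedSpheres
import Literature.Geometry.Symplectic.JCurveIntersectionCountHomological
import Literature.AlgebraicTopology.SingularHomology.SingularChains
import Mathlib.Topology.Metrizable.Urysohn
import Mathlib.Topology.Sequences
import Mathlib.Topology.Connected.Clopen

/-!
# Limits of points on leaves lie on leaves; every point lies on a leaf
(registered helpers `helper_limit_leaf` (L6) and `helper_leaf_cover` (L7) of line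
`cross-cap-laurent`, crux `GromovRecognitionRelEnd`, item stmt-SmoothPoincare4-11009; integration
lemmas of the glue of the bi-foliation)

Setting: the data `FoliationData ωX JX u₀ v₀ uH vH F₀ TH TV UH UV δ` of one foliation of the wedge
cap (`…GlueData`) and the vendored facts F1 (`hls_localFoliation_embeddedSphere_trivialNormal`),
F2 (`gromovCompactness_spheres_dichotomy`), F6 (`jSphere_wedgeCount_factorsThroughHomology`) and
F4 (`adjunction_embedded_of_somewhereInjective_sphere`) as HYPOTHESES.

* `helper_limit_leaf` (L6): if `(us n, vs n)` are leaves of the family of `F₀` and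
  `ys n ∈ pairImage (us n) (vs n)` converge to `y`, there is a leaf through `y`.  Proof: choose the
  glued maps `Fs n ∼ F₀` of the leaves (`ys n ∈ range (Fs n)` by `helper_gluedRange`) and apply
  Gromov compactness F2.  In case (B) the `m ≥ 2` non-constant bubbles `(Bu j, Bv j)` have glued
  classes adding up to `(Fs n)_*[ℂℙ¹] = (F₀)_*[ℂℙ¹]` (`singularHomology.map_eq_of_homotopic`), so
  `helper_caseBCounts` produces a bubble inside-or-disjoint from both zero sets
  `{TH = 0} ∩ UH = im S_H` and `{TV = 0} ∩ UV = im S₀` (`zeroSetH`, `zeroSetV`), which is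
  impossible by `helper_sphereTrappedConst` (`inter_eq`, `pi2`, `nullH`, `nullV`).  In case (A)
  `helper_caseA_leaf` gives the leaf.
* `helper_leaf_cover` (L7): the set `S` of points lying on some leaf is non-empty (the reference
  sphere is a leaf, `helper_leaf_ref`), open (around a leaf, `helper_leaf_chart` sweeps an open
  neighbourhood by leaves) and closed (`X` is compact Hausdorff second countable, hence metrisable
  and sequential; sequential closedness is L6); `X` being connected, `S = univ`.

References: M. Gromov, Invent. Math. 82 (1985), 2.4.A–2.4.A₁; D. McDuff, J. Amer. Math. Soc. 3
(1990), §3 (Lemma 3.1, Prop. 4.1); D. McDuff, D. Salamon, *J-holomorphic curves and symplectic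
topology*, 2nd ed. (2012), Thm. 5.3.1, §9.4.  No new definitions, notation or instances.
-/

noncomputable section

open scoped Manifold ContDiff Topology
open Set Function Filter Literature.Topology.FourManifolds Literature.Topology.FourManifolds.ComplexProjectiveSpace
  Literature.Geometry.Kaehler Literature.Geometry.Symplectic Literature.AlgebraicTopology.SingularHomology

-- the prescribed namespace `Summit.<P>.<Sub>.…` duplicates `SmoothPoincare4` (P = Sub)
set_option linter.dupNamespace false

namespace Summit.SmoothPoincare4.SmoothPoincare4.Theorems.GromovRecognitionRelEnd.CrossCapLaurent

/-- **L6 (registered helper `helper_limit_leaf`): limits of points on leaves lie on leaves.**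
With the foliation data and the facts F2 (Gromov compactness, dichotomy form), F6 and F4 as
hypotheses: for leaves `(us n, vs n)` of the family of `F₀` and points
`ys n ∈ pairImage (us n) (vs n)` with `ys n → y`, there is a leaf through `y`.  The glued maps
`Fs n ∼ F₀` of the leaves contain the `ys n` in their ranges; Gromov compactness either converges
modulo reparametrisation (case (A): `helper_caseA_leaf` gives the leaf) or splits the energy into
`m ≥ 2` non-constant bubbles representing `(F₀)_*[ℂℙ¹]` in total (case (B)), one of which is then
inside-or-disjoint from both wedge spheres (`helper_caseBCounts`) — impossible
(`helper_sphereTrappedConst`). -/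
theorem helper_limit_leaf : ∀ (X : Type) [TopologicalSpace X] [T2Space X]
    [SecondCountableTopology X] [CompactSpace X] [ConnectedSpace X]
    [ChartedSpace (EuclideanSpace ℝ (Fin 4)) X] [IsManifold (𝓡 4) ∞ X] (ωX : MForm (𝓡 4) X ℝ 2)
    (JX : AlmostComplexStructure (𝓡 4) ∞ X) (u₀ v₀ uH vH : ℂ → X)
    (F₀ : C(ComplexProjectiveSpace 1, X)) (TH TV : X → ℂ) (UH UV : Set X) (δ : ℝ),
    gromovCompactness_spheres_dichotomy → jSphere_wedgeCount_factorsThroughHomology →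
    adjunction_embedded_of_somewhereInjective_sphere →
    FoliationData ωX JX u₀ v₀ uH vH F₀ TH TV UH UV δ →
    ∀ (us vs : ℕ → ℂ → X) (ys : ℕ → X) (y : X),
    (∀ n, IsLeafOf (fun y => JX y) F₀ (us n) (vs n)) → (∀ n, ys n ∈ pairImage (us n) (vs n)) →
    Tendsto ys atTop (𝓝 y) →
    ∃ u v : ℂ → X, IsLeafOf (fun y => JX y) F₀ u v ∧ y ∈ pairImage u v := by
  intro X _ _ _ _ _ _ _ ωX JX u₀ v₀ uH vH F₀ TH TV UH UV δ hF2 hfact hadj D us vs ys y hleaf hys hy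
  -- the glued maps of the leaves, homotopic to `F₀`, containing the points `ys n`
  choose Fs hFs hhom using fun n => (hleaf n).glued
  have hysF : ∀ n, ys n ∈ Set.range (Fs n) := fun n => by
    rw [helper_gluedRange X (us n) (vs n) (Fs n) (hleaf n).sphere.compat (hFs n).chart_zero
      (hFs n).chart_one, ← pairImage_eq]
    exact hys n
  -- Gromov compactness
  obtain ⟨φ, hφ, hA | hB⟩ := hF2 X ωX JX us vs Fs F₀ D.smoothForm D.closedForm D.tamed
    (fun n => ⟨(hleaf n).sphere.smooth_u, (hleaf n).sphere.smooth_v, (hleaf n).sphere.compat,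
      (hleaf n).sphere.hol_u, (hleaf n).sphere.hol_v, (hFs n).chart_zero, (hFs n).chart_one,
      hhom n⟩)
  · -- case (A): convergence modulo reparametrisation gives a leaf through `y`
    obtain ⟨u, v, F, A, hu, hv, huv, hJu, hJv, hF0, hF1, hlim⟩ := hA
    exact helper_caseA_leaf X ωX JX u₀ v₀ uH vH F₀ TH TV UH UV δ hfact hadj D Fs ys y φ u v F A
      hhom hysF hy hφ ⟨hu, hv, huv, hJu, hJv⟩ ⟨hF0, hF1⟩ hlim
  · -- case (B): bubbling is excluded by the wedge counts
    exfalso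
    obtain ⟨m, Bu, Bv, G, hm, hB, hsum, -, -⟩ := hB
    -- the bubbles represent the class of `F₀` in total
    have hsum₀ : ∑ j, singularHomology.map ℤ ℤ (G j) (2 * 1)
          (ComplexProjectiveSpace.homologicalOrientationInt 1).fundamentalClass =
        singularHomology.map ℤ ℤ F₀ (2 * 1)
          (ComplexProjectiveSpace.homologicalOrientationInt 1).fundamentalClass := by
      rw [hsum 0, singularHomology.map_eq_of_homotopic ℤ ℤ (hhom 0) (2 * 1)]
    -- the reference sphere lies in the zero set of `TV`
    have hmemH : ∀ x : X, x ∈ pairImage uH vH ↔ (x ∈ UH ∧ TH x = 0) := fun x => by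
      rw [← D.zeroSetH]
      rfl
    have hmemV : ∀ x : X, x ∈ pairImage u₀ v₀ ↔ (x ∈ UV ∧ TV x = 0) := fun x => by
      rw [← D.zeroSetV]
      rfl
    have hV₀ : ∀ z : ℂ, u₀ z ∈ UV ∧ TV (u₀ z) = 0 := fun z =>
      (hmemV _).1 ((mem_pairImage_iff u₀ v₀ _).2 (Or.inl ⟨z, rfl⟩))
    have hV₀' : v₀ 0 ∈ UV ∧ TV (v₀ 0) = 0 := (hmemV _).1 ((mem_pairImage_iff u₀ v₀ _).2 (Or.inr rfl))
    -- the reference count, unfolded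
    have hcnt : ∀ t : ℂ, ‖t‖ < δ →
        (∑ᶠ z ∈ {z : ℂ | u₀ z ∈ UH ∧ (fun y => TH y - t) (u₀ z) = 0},
            (meromorphicOrderAt ((fun y => TH y - t) ∘ u₀) z).untop₀) +
          (∑ᶠ w ∈ {w : ℂ | w = 0 ∧ v₀ w ∈ UH ∧ (fun y => TH y - t) (v₀ w) = 0},
            (meromorphicOrderAt ((fun y => TH y - t) ∘ v₀) w).untop₀) = 1 :=
      fun t ht => (wedgeCount_eq (fun y => TH y - t) UH u₀ v₀).symm.trans (D.count_ref t ht)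
    -- a bubble inside-or-disjoint from both zero sets
    obtain ⟨j, hjH, hjV⟩ := helper_caseBCounts X JX hfact TH TV UH UV δ u₀ v₀ F₀ m Bu Bv G
      D.coordH.isOpen D.coordH.smooth D.coordH.hol D.coordH.mfderiv_ne_zero D.levelsH
      D.coordV.isOpen D.coordV.smooth D.coordV.hol D.coordV.mfderiv_ne_zero D.levelsV D.δ_pos
      D.ref_sphere.smooth_u D.ref_sphere.smooth_v D.ref_sphere.compat D.ref_sphere.hol_u
      D.ref_sphere.hol_v D.ref_glued.chart_zero D.ref_glued.chart_one hV₀ hV₀' D.ref_off hcnt hm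
      hB hsum₀
    obtain ⟨hBu, hBv, hBc, hBJu, hBJv, hBne, hG0, hG1⟩ := hB j
    -- it is trapped: inside-or-disjoint from both wedge spheres, hence constant — contradiction
    refine helper_sphereTrappedConst X ωX JX (pairImage uH vH) (pairImage u₀ v₀) (v₀ 0) (Bu j)
      (Bv j) (G j) D.smoothForm D.closedForm D.tamed D.inter_eq
      (fun u' v' hu' hv' hc' hJu' hJv' => D.pi2 u' v' ⟨hu', hv', hc', hJu', hJv'⟩) D.nullH D.nullV
      hBu hBv hBc hBJu hBJv hG0 hG1 hBne ?_ ?_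
    · rcases hjH with ⟨h1, h2⟩ | ⟨h1, h2⟩
      · exact Or.inl ⟨fun z => (hmemH _).2 (h1 z), (hmemH _).2 h2⟩
      · exact Or.inr ⟨fun z h => h1 z ((hmemH _).1 h), fun h => h2 ((hmemH _).1 h)⟩
    · rcases hjV with ⟨h1, h2⟩ | ⟨h1, h2⟩
      · exact Or.inl ⟨fun z => (hmemV _).2 (h1 z), (hmemV _).2 h2⟩
      · exact Or.inr ⟨fun z h => h1 z ((hmemV _).1 h), fun h => h2 ((hmemV _).1 h)⟩

/-- **L7 (registered helper `helper_leaf_cover`): every point lies on a leaf.**  The set `S` of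
points of `X` lying on a leaf of the family of `F₀` is non-empty (`u₀ 0`, the reference sphere
being a leaf by `helper_leaf_ref`), open (a point on the leaf `(u, v)` lies in the open set swept
by the family of leaves `(U a, V a)`, `‖a‖ < ε`, of `helper_leaf_chart`, member `a = 0` being
`(u, v)`), and closed (`X` is metrisable, so closedness is sequential closedness, which is
`helper_limit_leaf`); `X` is connected, so `S = univ`. -/
theorem helper_leaf_cover : ∀ (X : Type) [TopologicalSpace X] [T2Space X]
    [SecondCountableTopology X] [CompactSpace X] [ConnectedSpace X]
    [ChartedSpace (EuclideanSpace ℝ (Fin 4)) X] [IsManifold (𝓡 4) ∞ X] (ωX : MForm (𝓡 4) X ℝ 2)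
    (JX : AlmostComplexStructure (𝓡 4) ∞ X) (u₀ v₀ uH vH : ℂ → X)
    (F₀ : C(ComplexProjectiveSpace 1, X)) (TH TV : X → ℂ) (UH UV : Set X) (δ : ℝ),
    hls_localFoliation_embeddedSphere_trivialNormal → gromovCompactness_spheres_dichotomy →
    jSphere_wedgeCount_factorsThroughHomology → adjunction_embedded_of_somewhereInjective_sphere →
    FoliationData ωX JX u₀ v₀ uH vH F₀ TH TV UH UV δ →
    ∀ y : X, ∃ u v : ℂ → X, IsLeafOf (fun y => JX y) F₀ u v ∧ y ∈ pairImage u v := by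
  intro X _ _ _ _ _ _ _ ωX JX u₀ v₀ uH vH F₀ TH TV UH UV δ hF1 hF2 hfact hadj D
  -- the set of points lying on a leaf is clopen and non-empty in the connected `X`
  suffices h : {y : X | ∃ u v : ℂ → X, IsLeafOf (fun y => JX y) F₀ u v ∧ y ∈ pairImage u v} =
      univ from fun y => (h.symm ▸ mem_univ y :)
  refine IsClopen.eq_univ ⟨?_, ?_⟩ ⟨u₀ 0, u₀, v₀,
    helper_leaf_ref X ωX JX u₀ v₀ uH vH F₀ TH TV UH UV δ D,
    (mem_pairImage_iff u₀ v₀ _).2 (Or.inl ⟨0, rfl⟩)⟩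
  · -- closed: `X` is metrisable, hence sequential, and sequentially closed is L6
    haveI : TopologicalSpace.MetrizableSpace X :=
      TopologicalSpace.metrizableSpace_of_t3_secondCountable X
    refine IsSeqClosed.isClosed fun ys y hys hy => ?_
    choose us vs hl hm using hys
    exact helper_limit_leaf X ωX JX u₀ v₀ uH vH F₀ TH TV UH UV δ hF2 hfact hadj D us vs ys y hl
      hm hy
  · -- open: the local foliation around a leaf sweeps an open neighbourhood by leaves
    rw [isOpen_iff_forall_mem_open]
    rintro y ⟨u, v, hl, hyuv⟩
    obtain ⟨ε, U, V, hε, hU0, hV0, hleaf, -, -, -, -, hopen⟩ :=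
      helper_leaf_chart X JX F₀ hF1 hadj u v hl
    refine ⟨⋃ a ∈ Metric.ball (0 : ℂ) ε, (range (U a) ∪ {V a 0}), fun x hx => ?_, hopen, ?_⟩
    · obtain ⟨a, ha, hx⟩ := mem_iUnion₂.1 hx
      refine ⟨U a, V a, hleaf a (mem_ball_zero_iff.1 ha), ?_⟩
      rw [pairImage_eq]
      exact hx
    · have hU : U 0 = u := funext hU0
      have hV : V 0 = v := funext hV0
      refine mem_iUnion₂.2 ⟨0, Metric.mem_ball_self hε, ?_⟩
      rw [hU, hV, ← pairImage_eq]
      exact hyuv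

end Summit.SmoothPoincare4.SmoothPoincare4.Theorems.GromovRecognitionRelEnd.CrossCapLaurent

end
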